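import Mathlib.LinearAlgebra.Dimension.Constructions
import Mathlib.LinearAlgebra.FiniteDimensional.Basic
import Mathlib.SetTheory.Cardinal.Finite
import Literature.NumberTheory.Transcendental.MultipleZetaValuesProofs
import Literature.NumberTheory.Transcendental.MultipleZetaValuesDimBoundProofs
import Literature.NumberTheory.Transcendental.MultipleZetaEulerProofs
import Literature.NumberTheory.Transcendental.MultipleZetaValuesWeightFourProofs
import Literature.NumberTheory.Transcendental.MultipleZetaWeightFiveProofs
import Literature.NumberTheory.Transcendental.MultipleZetaWeightSixProofs
import Literature.NumberTheory.Transcendental.MultipleZetaWeightSevenProofs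
import Literature.NumberTheory.Transcendental.MultipleZetaWeightEightProofs
import Literature.NumberTheory.Transcendental.MultipleZetaWeightNineProofs
import HarnessLib

/-!
# Brown's theorem (Hoffman elements span the MZVs) — status, reductions, low weights

Sibling proof file of `Literature.NumberTheory.Transcendental.MultipleZetaValues`, about its named
fact `Literature.NumberTheory.Transcendental.hoffmanSpan_eq_mzvSpace`
(`∀ n, hoffmanSpan n = mzvSpace n`: the multiple zeta values `ζ(s₁, …, s_k)` with all
`sᵢ ∈ {2, 3}` and `s₁ + ⋯ + s_k = n` span the `ℚ`-space `𝒵_n` of all MZVs of weight `n`).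
Theorems only: no definition is added, no statement is changed, no named fact is introduced
(companions: `MultipleZetaValuesDimBoundProofs.lean` — the count `#{w ∈ {2,3}^× of weight n} = d_n`
(`zagierDim_eq_card_hoffman_holds`) and "Brown ⟹ `dim_ℚ 𝒵_n ≤ d_n`"
(`finrank_mzvSpace_le_zagierDim_of_hoffmanSpan_eq`); `MultipleZetaValuesProofs.lean` — the
weight spaces `𝒵₀, …, 𝒵₃`).

## The source and the status of the fact (why there is no `hoffmanSpan_eq_mzvSpace_holds` yet)

F. Brown, *Mixed Tate motives over `ℤ`* [Brown2012]. As printed (§1): *Conjecture 2* (Hoffman)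
"Every multiple zeta value (1.1) is a `ℚ`-linear combination of
`{ζ(n₁, …, n_r) : n₁, …, n_r ∈ {2, 3}}`"; *Theorem 1.1* "The set of elements
`{ζᵐ(n₁, …, n_r), nᵢ ∈ {2, 3}}` are a basis of the `ℚ`-vector space of motivic multiple zeta
values"; "Conjecture 2 follows from theorem 1.1 by applying the period map" (§1, and §7.2,
Corollary 7.5: "Every motivic multiple zeta value `ζᵐ(a₁, …, a_n)` is a `ℚ`-linear combination of
`ζᵐ(w)`, for `w ∈ {2,3}^×`. This implies conjecture 2."). Brown sums over `0 < k₁ < ⋯ < k_r`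
with `n_r ≥ 2`, the mirror image of Zagier's convention `n₁ > ⋯ > n_k ≥ 1`, `s₁ ≥ 2` used by
`multipleZeta`; the set of Hoffman indices is invariant under reversal, the space `𝓗` of motivic
MZVs is graded by the weight and the period map respects the weight, so the weight-by-weight
statement `hoffmanSpan n = mzvSpace n` is exactly Conjecture 2 as obtained from Theorem 1.1 — the
fact is faithfully stated.

Architecture of the printed proof [Brown2012]: (1) the Tannakian category `MT(ℤ)` with
`G_MT = G_U ⋊ 𝔾_m`, `A^MT = 𝒪(G_U)` cofree on cogenerators `f₃, f₅, …` (Deligne–Goncharov,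
Borel), whence `𝓗^{MT₊} ≅ 𝒰 = ℚ⟨f₃, f₅, …⟩ ⊗ ℚ[f₂]` ((2.22)) with Poincaré series
`1 / (1 - t² - t³)` (Lemma 2.5); (2) motivic MZVs `𝓗 = 𝒪(₀Π₁)/J^MT` (Definition 2.1) on the
motivic torsor of paths of `ℙ¹ ∖ {0, 1, ∞}`, Goncharov's coaction (Theorem 2.4) and the period
map `per : 𝓗 → ℝ` ((2.11)); (3) the derivations `D_{2r+1}` with
`ker D_{<N} ∩ 𝓗_N = ℚ ζᵐ(N)` (Theorem 3.3); (4) Zagier's evaluation of `ζ(2,…,2,3,2,…,2)`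
(Theorem 4.1) and its motivic lift (Theorem 4.3) with the `2`-adic properties of the coefficients
`c_w` (Corollary 4.4, Lemma 3.8); (5) the level filtration and the matrices `M_{N,ℓ}`
(§§5–6), their `2`-adic invertibility (Lemma 7.1, Theorem 7.3), and induction on the level:
*Theorem 7.4* "The elements `{ζᵐ(w) : w ∈ {2,3}^×}` are linearly independent"; then the count
(7.2) `dim 𝓗^{2,3}_N = #{w ∈ {2,3}^× of weight N} = d_N` turns `𝓗^{2,3} ⊆ 𝓗 ⊆ 𝓗^{MT₊}` into
equalities. Steps (1)–(5) are theories absent from Mathlib and from this tree (no mixed Tate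
motives, no motivic fundamental groupoid or Drinfeld associator, no Zagier `2-3-2` theorem), and
the printed proof is motivic at two essential points (Brown, §8: "Apart from the final step of
§7.2, the only other place where we use the structure of the category `MT(ℤ)` is in theorem 4.3.
A proof of theorem 4.3 using standard relations would give a purely combinatorial proof that
`dim 𝓗_N ≥ d_N`"). So the discharge is out of reach here; users keep the explicit hypothesis
`(h : hoffmanSpan_eq_mzvSpace)`. This file records, sorry-free, the formalizable part.

## What is proved here

* `hoffmanSpan_eq_mzvSpace_iff` — the fact in the printed form of Conjecture 2: every MZV of an
  admissible index lies in the Hoffman span of its weight; `hoffmanSpan_eq_mzvSpace_of_forall_mem`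
  — the weight-`n` criterion (the inclusion `hoffmanSpan n ≤ mzvSpace n` being unconditional).
* `hoffmanSpan_eq_mzvSpace_of_linearIndependent` — the real shadow of Brown's dimension
  argument (7.2) ("the inclusions `𝓗^{2,3} ⊆ 𝓗 ⊆ 𝓗^{MT₊}` are therefore all equalities, since
  their dimensions in graded weight `N` are equal"): in a weight where `dim_ℚ 𝒵_n ≤ d_n` and the
  `d_n` real Hoffman elements are linearly independent, they span `𝒵_n` and `dim_ℚ 𝒵_n = d_n`
  (pure linear algebra over the count `zagierDim_eq_card_hoffman_holds`; the independence
  hypothesis is open for real MZVs from weight `5` on).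
* `finrank_mzvSpace_le_zagierDim_of_eq` — in a single weight, `hoffmanSpan n = mzvSpace n` gives
  `dim_ℚ 𝒵_n ≤ d_n` (the weight-wise form of `finrank_mzvSpace_le_zagierDim_of_hoffmanSpan_eq`).
* `hoffmanSpan_eq_mzvSpace_of_le_three` — the fact in weights `n ≤ 3`, unconditionally (weight `3`
  is Euler's `ζ(2,1) = ζ(3)`, `euler_zeta_two_one_holds`); so `finrank_mzvSpace_le_zagierDim` holds
  in weights `≤ 3` (`finrank_mzvSpace_le_zagierDim_of_le_three`).
* `hoffmanSpan_four_eq`, `hoffmanSpan_eq_mzvSpace_of_le_four` — the fact in weight `4` (the only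
  Hoffman index is `(2,2)`, and `𝒵₄ = ℚ π⁴ = ℚ ζ(2,2)` by the weight-`4` evaluations
  `ζ(4) = π⁴/90`, `ζ(3,1) = π⁴/360`, `ζ(2,2) = π⁴/120`, `ζ(2,1,1) = π⁴/90` of
  `MultipleZetaDepthTwoProofs.lean`, `MultipleZetaHoffmanRelationProofs.lean`,
  `MultipleZetaValuesWeightFourProofs.lean`: Euler's stuffle and sum formula, Hoffman's relation
  and duality in weight `4`), hence in all weights `n ≤ 4` — exactly the weights with `d_n ≤ 1`;
  `finrank_mzvSpace_le_zagierDim_of_le_four`.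
* `hoffmanSpan_five_eq`, `hoffmanSpan_eq_mzvSpace_of_le_five` — the fact in weight `5`, the first
  weight with `d_n = 2` (Hoffman indices `(3,2)`, `(2,3)`): every weight-`5` MZV is a rational
  combination of `ζ(3,2)`, `ζ(2,3)` (`multipleZeta_mem_span_hoffman_of_weight_five`,
  `MultipleZetaWeightFiveProofs.lean`, from the double shuffle relations of weight `5` —
  stuffle `ζ(2)ζ(3) = ζ(2,3) + ζ(3,2) + ζ(5)`, shuffle `ζ(2)ζ(3) = ζ(2,3) + 3ζ(3,2) + 6ζ(4,1)`
  (`MultipleZetaShuffleProofs.lean`) — and the duality theorem `MultipleZetaDuality.lean`);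
  hence `finrank_mzvSpace_le_zagierDim_of_le_five : dim_ℚ 𝒵_n ≤ d_n` for `n ≤ 5`, the
  Goncharov–Terasoma bound through its first case with `d_n > 1`.
* `hoffmanSpan_six_eq`, `hoffmanSpan_eq_mzvSpace_of_le_six` — the fact in weight `6` (`d₆ = 2`,
  Hoffman indices `(2,2,2)`, `(3,3)`): every weight-`6` MZV is a rational combination of
  `ζ(2,2,2) = π⁶/5040` and `ζ(3,3) = (ζ(3)² - ζ(6))/2` (`multipleZeta_mem_span_hoffman_of_weight_six`,
  `MultipleZetaWeightSixProofs.lean`: the seven stuffle products of weight `6`, the shuffles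
  `ζ(2)ζ(4)`, `ζ(3)²`, the six dualities, `ζ(6) = π⁶/945` and the weight-`4` evaluations); hence
  `finrank_mzvSpace_le_zagierDim_of_le_six`. This covers exactly the range `n ≤ 6` of Hoffman's
  original verification (Hoffman 1992, §5: "all instances of both conjectures are true when
  `n = 6`").
* `hoffmanSpan_seven_eq`, `hoffmanSpan_eq_mzvSpace_of_le_seven` — the fact in weight `7`
  (`d₇ = 3`, Hoffman indices `(3,2,2)`, `(2,3,2)`, `(2,2,3)`), the first weight needing the
  shuffle product in depth `1 × 2` (`MZVWordShuffleProofs.lean`: the shuffle product formula via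
  Kontsevich's integrals): `multipleZeta_mem_span_hoffman_of_weight_seven`
  (`MultipleZetaWeightSevenProofs.lean`); hence `finrank_mzvSpace_le_zagierDim_of_le_seven`.
* `hoffmanSpan_eight_eq`, `hoffmanSpan_eq_mzvSpace_of_le_eight` — the fact in weight `8`
  (`d₈ = 4`, Hoffman indices `(2,2,2,2)`, `(2,3,3)`, `(3,2,3)`, `(3,3,2)`; the first weight with an
  irreducible double zeta value, `ζ(6,2)`): `multipleZeta_mem_span_hoffman_of_weight_eight`
  (`MultipleZetaWeightEightProofs.lean`, from sixty-three finite double shuffle and duality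
  relations); hence `finrank_mzvSpace_le_zagierDim_of_le_eight : dim_ℚ 𝒵_n ≤ d_n` for `n ≤ 8`.
* `hoffmanSpan_nine_eq`, `hoffmanSpan_eq_mzvSpace_of_le_nine` — the fact in weight `9` (`d₉ = 5`,
  Hoffman indices `(3,3,3)`, `(3,2,2,2)`, `(2,3,2,2)`, `(2,2,3,2)`, `(2,2,2,3)`):
  `multipleZeta_mem_span_hoffman_of_weight_nine` (`MultipleZetaWeightNineProofs.lean` and its three
  predecessors: one hundred and fifty-six finite double shuffle and duality relations, evaluations
  by explicit certificates); hence `finrank_mzvSpace_le_zagierDim_of_le_nine : dim_ℚ 𝒵_n ≤ d_n`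
  for `n ≤ 9` (`d₀, …, d₉ = 1, 0, 1, 1, 1, 2, 2, 3, 4, 5`).

## The elementary part of Brown's proof, the all-weights families, and the reduction to the motivic data (sibling files, 2026-08-15)

Everything in [Brown2012] that does not itself live in the motivic world is now a theorem of this
tree, and the motivic remainder is isolated as the fields of one structure:
* the printed lemmas — (3.7) `ζ({2}ⁿ) = π²ⁿ/(2n+1)!` (`multipleZeta_replicate_two`,
  `MultipleZetaRepeatedTwosProofs`); Lemma 3.8 for real MZVs and Newton's identities
  (`sum_multipleZeta_twos_insert_three`, `MultipleZetaNewtonProofs`); Lemma 4.2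
  (`Brown2012.lemma_4_2_A/B`, `BrownZagierCompatibilityProofs`); the coefficients `A, B, c_w` of §4 and
  Corollary 4.4 (`BrownZagierCoefficients`); Theorem 4.1 (Zagier) in weights `≤ 9`
  (`BrownZagierFormulaLowWeightProofs`); Lemma 7.1 (`Brown2012.lemma_7_1`, `BrownMixedTateLemmas`);
  §§5–6 (level, `B_{N,ℓ}`, `B'_{N,ℓ}`, (6.2), the deconcatenation matrices, Corollary 6.2) and
  Theorem 7.3 in all levels through the interface of Theorem 6.1 (`Brown2012.isUnit_levelMatrix_add`,
  `BrownLevelMatrices`; level one with the full Zagier matrix and the conditional consequence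
  "Zagier's theorem ⟹ `ζ(2n+1) ∈ hoffmanSpan (2n+1)`", `BrownLevelOneProofs`);
* the fact in whole families of all weights — `π²ⁿ`, `ζ(2k)`, `ζ(2a)ζ(2b)`, `ζ({2a}ⁿ)`
  (`MultipleZetaRepeatedTwosProofs`, `MultipleZetaNewtonProofs`), `ζ({3,1}ⁿ) = 2π⁴ⁿ/(4n+2)!`
  (Zagier–Broadhurst, `MultipleZetaThreeOneProofs`), `ζ({4}ⁿ) = 2^{2n+1}π⁴ⁿ/(4n+2)!`
  (`MultipleZetaRepeatedFoursProofs`), and the duals of all Hoffman words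
  (`MultipleZetaHoffmanDualProofs`);
* the reduction — §7.2 abstractly: `Brown2012.HoffmanModel` (the inputs of Corollary 7.5 per weight)
  with `hoffmanSpan_eq_mzvSpace_of_hoffmanModel` (`BrownHoffmanModel`), and Theorem 7.4 itself
  proved by Brown's induction on the level from `Brown2012.LevelData` = (a space with vectors
  `ζᵐ(w)`, operators `D r`, the level lowering of Lemmas 3.4/5.5 and the matrix congruence of
  Theorem 6.1), whence `hoffmanSpan_eq_mzvSpace_of_motivicData : Brown2012.MotivicData →
  hoffmanSpan_eq_mzvSpace` (`BrownLinearIndependence`; the axioms are consistent,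
  `BrownLevelDataFreeModel`). What a discharge still needs is precisely an inhabitant of
  `Brown2012.MotivicData`, i.e. `MT(ℤ)`, motivic MZVs with their period map, the derivations
  `D_{2r+1}` with Lemma 5.5, and Theorem 6.1 (with Theorem 4.3) — and, for the level-one real
  route, Zagier's Theorem 4.1 in general.

## Update (2026-08-15, later): the coaction layers, Zagier's theorem for all weights, low depth

Since the paragraph above was written, the reduction was pushed through Brown's §§3–6 and the real
input was discharged:
* Theorem 6.1, Lemmas 5.3/5.5 and the level data are THEOREMS from the projected coaction formula
  (`Brown2012.CoactionData`, `BrownCoactionCalculus`; formal window calculus `BrownWindowCalculus`),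
  and (3.9), Lemma 3.5, Corollary 3.6/(3.12), Theorem 4.3 (motivic Zagier) and Theorem 3.3 (from an
  injective derivation-compatible `φ : 𝓗 ↪ 𝒰` and Lemma 2.7) are theorems from the full coaction
  (`Brown2012.FullCoactionData` / `Brown2012.UCoactionData`, `BrownDepthOneLift`), whence
  `hoffmanSpan_eq_mzvSpace_of_uCoactionData (G) (hZ)`;
* **Zagier's theorem (Brown's Theorem 4.1) for ALL `a, b`** is proved (`LaiLupuOrr.zagier_theorem`,
  `BrownZagierFormulaProofs`, by the elementary method of Lai–Lupu–Orr 2026 on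
  `Literature.Analysis.SpecialFunctions.ArcsinPowerSeries`, `…CotangentMoments` and
  `BrownZagierTailSums`), so the hypothesis `hZ` is gone:
  `hoffmanSpan_eq_mzvSpace_of_uCoactionData' : Brown2012.UCoactionData → hoffmanSpan_eq_mzvSpace`.
  **What a discharge still needs is exactly an inhabitant of `Brown2012.UCoactionData`** — the
  algebra of motivic multiple zeta values with the Goncharov–Brown coaction, its period map and
  `𝓗 ↪ 𝒰` (Brown §2: `MT(ℤ)`, Deligne–Goncharov, Borel) — a theory absent from Mathlib;
* unconditional consequences in all weights: `ζ(2n+1) ∈ hoffmanSpan (2n+1)` and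
  `ζ(2j+3) ζ({2}ᵐ) ∈ hoffmanSpan` (`multipleZeta_odd_mem_hoffmanSpan`, Brown's level-one argument +
  Zagier's theorem, `BrownZagierFormulaProofs`); hence every MZV of depth one lies in the Hoffman
  span of its weight, and — by Euler's theorem on double zeta values of odd weight, proved from the
  tree's finite double shuffle relations — so does every MZV of depth two and odd weight
  (`multipleZeta_depth_two_mem_hoffmanSpan_of_odd`, `BrownHoffmanLowDepthProofs`).

## Update (2026-08-15, last): the motivic input as printed

`BrownMotivicMZV.lean` replaces `Brown2012.UCoactionData` as the input by `Brown2012.MotivicMZV`,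
whose fields are one by one statements printed in Brown's §2 and §3.1, in `𝒰`-coordinates: the
weight-graded algebra `𝓗` with the `Iᵐ(0; u; 1)`, I0, I1, the period map ((2.11), (2.19)), a
weight-preserving `φ : 𝓗 → 𝒰` injective on each `𝓗_N` ((2.15), (2.22)) intertwining the
contracted derivations `∂ʰ_{2r+1} = (f^∨_{2r+1} ⊗ id) ∘ D_{2r+1}` (Definition 3.1, (3.3),
Goncharov's formula (3.4)) with `∂_{2r+1}`, "`π` kills products" ((3.1)), and (3.8). Lemma 3.4,
(3.9), Lemma 3.5, Theorem 3.3, the normalisation (3.6), `φ(ζᵐ(N)) ∈ ℚ^× f_N` and — with no motivic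
stuffle — Lemma 3.8 (lifted from the real identity through Theorem 3.3 and the period map) are
theorems there, whence
`hoffmanSpan_eq_mzvSpace_of_motivicMZV : Brown2012.MotivicMZV → hoffmanSpan_eq_mzvSpace` and
`finrank_mzvSpace_le_zagierDim_of_motivicMZV`. **A discharge of either `periods.S24` fact needs
exactly an inhabitant of `Brown2012.MotivicMZV`** — the existence of motivic multiple zeta values
with Goncharov's coaction, their period map and `𝓗 ↪ H^{MT⁺} ≅ 𝒰` (`MT(ℤ)`, Deligne–Goncharov,
Borel): a theorem in print of size XL which a proving seat may not vendor as a named fact (D-0026,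
`lint.fact-fanout`) and which no elementary argument replaces (Brown, §8: apart from Theorem 4.3 —
now a theorem of the tree for real MZVs — the structure of `MT(ℤ)` enters exactly in the count
(7.2) of §7.2).

## References

* [Brown2012] F. Brown, *Mixed Tate motives over `ℤ`*, Ann. of Math. (2) 175 (2012), 949–976
  (arXiv:1102.1312): §1 Conjecture 2, Theorem 1.1; Lemma 2.5; §7.2 Theorem 7.4, (7.2), Corollary 7.5; §8.
* [Hoffman1997] M. E. Hoffman, *The algebra of multiple harmonic series*, J. Algebra 194 (1997),
  477–495 (the conjectural basis `{ζ(w) : w ∈ {2,3}^×}`).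
* [Zagier1994] D. Zagier, *Values of zeta functions and their applications*, ECM 1992, Vol. II,
  Progr. Math. 120 (1994), 497–512, §9 (`d_n`).

## Design notes

* Nothing of `MultipleZetaValues.lean` is restated or modified; imports: `MultipleZetaValuesProofs`
  (weights `≤ 3` of `𝒵_n`), `MultipleZetaValuesDimBoundProofs` (`MZV.isHoffman_nil/_cons`,
  `finite_hoffman`, `zagierDim_eq_card_hoffman_holds`, `finrank_hoffmanSpan_le_zagierDim`),
  `MultipleZetaEulerProofs` (`euler_zeta_two_one_holds`), `MultipleZetaValuesWeightFourProofs`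
  (`mzvSpace_four_eq`, `multipleZeta_mem_span_pi_pow_four`, and through it `multipleZeta_two_two`),
  `MultipleZetaWeightFiveProofs` (`multipleZeta_mem_span_hoffman_of_weight_five`,
  `mzvSpace_five_eq_span_hoffman`), `MultipleZetaWeightSixProofs`
  (`multipleZeta_mem_span_hoffman_of_weight_six`, `mzvSpace_six_eq_span_hoffman`),
  `MultipleZetaWeightSevenProofs` (`multipleZeta_mem_span_hoffman_of_weight_seven`,
  `mzvSpace_seven_eq_span_hoffman`), `MultipleZetaWeightEightProofs`
  (`multipleZeta_mem_span_hoffman_of_weight_eight`, `mzvSpace_eight_eq_span_hoffman`),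
  `MultipleZetaWeightNineProofs` (`multipleZeta_mem_span_hoffman_of_weight_nine`,
  `mzvSpace_nine_eq_span_hoffman`),
  `Mathlib.LinearAlgebra.Dimension.Constructions` (`finrank_span_eq_card`),
  `Mathlib.LinearAlgebra.FiniteDimensional.Basic` (`Submodule.eq_of_le_of_finrank_le`).
* The Hoffman indices of weight `n` are the subtype
  `{s : List ℕ // MZV.IsHoffman s ∧ MZV.weight s = n}` of the fact `zagierDim_eq_card_hoffman`.
-/

noncomputable section

namespace Literature.NumberTheory.Transcendental

namespace MZV

/-! ### Hoffman indices -/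

/-- A one-letter index `(a)` with `a ∈ {2, 3}` is a Hoffman index. [folklore] -/
theorem isHoffman_singleton {a : ℕ} (ha : a = 2 ∨ a = 3) : IsHoffman [a] :=
  isHoffman_cons.2 ⟨ha, isHoffman_nil⟩

end MZV

/-! ### The Hoffman span as the span of a finite family; one weight at a time -/

/-- The Hoffman span of weight `n` is the span of the family `w ↦ ζ(w)` indexed by the Hoffman
indices of weight `n`. [folklore] -/
theorem hoffmanSpan_eq_span_range (n : ℕ) :
    hoffmanSpan n = Submodule.span ℚ (Set.range
      fun s : {s : List ℕ // MZV.IsHoffman s ∧ MZV.weight s = n} => multipleZeta s.1) := by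
  unfold hoffmanSpan
  congr 1
  ext x
  simp only [Set.mem_setOf_eq, Set.mem_range, Subtype.exists, exists_prop]
  constructor
  · rintro ⟨s, hs, hw, rfl⟩
    exact ⟨s, ⟨hs, hw⟩, rfl⟩
  · rintro ⟨s, ⟨hs, hw⟩, rfl⟩
    exact ⟨s, hs, hw, rfl⟩

/-- In a weight `n` where the Hoffman elements span `𝒵_n`, the upper bound `dim_ℚ 𝒵_n ≤ d_n`
holds (there are `d_n` Hoffman indices of weight `n`; the weight-wise form of
`finrank_mzvSpace_le_zagierDim_of_hoffmanSpan_eq`). [cite: Brown2012, §7.2 (7.2)] -/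
theorem finrank_mzvSpace_le_zagierDim_of_eq {n : ℕ} (h : hoffmanSpan n = mzvSpace n) :
    Module.finrank ℚ (mzvSpace n) ≤ zagierDim n := by
  rw [← h]
  exact finrank_hoffmanSpan_le_zagierDim n

/-- **The real shadow of Brown's dimension argument.** Brown concludes ((7.2) and after: "The
inclusions `𝓗^{2,3} ⊆ 𝓗 ⊆ 𝓗^{MT₊}` are therefore all equalities, since their dimensions in graded
weight `N` are equal") from linear independence of the `d_N` Hoffman elements (Theorem 7.4) and
the upper bound `d_N` on the dimension. The same linear algebra inside `ℝ`: in a weight `n` where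
`dim_ℚ 𝒵_n ≤ d_n` (the weight-`n` case of the named fact `finrank_mzvSpace_le_zagierDim`) and the
real Hoffman elements of weight `n` are `ℚ`-linearly independent (for real numbers an OPEN
statement from weight `5` on, where it says `ζ(5) ∉ ℚ ζ(2)ζ(3)`: it is the weight-`n` case of
Hoffman's basis conjecture and implies Zagier's `dim_ℚ 𝒵_n = d_n`; in weights `≤ 4` there is at
most one Hoffman index and it holds by positivity), the Hoffman elements span `𝒵_n` and
`dim_ℚ 𝒵_n = d_n`.
[cite: Brown2012, §7.2 (7.2)] -/
theorem hoffmanSpan_eq_mzvSpace_of_linearIndependent {n : ℕ}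
    (hle : Module.finrank ℚ (mzvSpace n) ≤ zagierDim n)
    (hli : LinearIndependent ℚ
      fun s : {s : List ℕ // MZV.IsHoffman s ∧ MZV.weight s = n} => multipleZeta s.1) :
    hoffmanSpan n = mzvSpace n ∧ Module.finrank ℚ (mzvSpace n) = zagierDim n := by
  haveI := finite_hoffman n
  letI := Fintype.ofFinite {s : List ℕ // MZV.IsHoffman s ∧ MZV.weight s = n}
  have hH : Module.finrank ℚ (hoffmanSpan n) = zagierDim n := by
    rw [hoffmanSpan_eq_span_range, finrank_span_eq_card hli, ← Nat.card_eq_fintype_card,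
      zagierDim_eq_card_hoffman_holds n]
  have heq : hoffmanSpan n = mzvSpace n :=
    Submodule.eq_of_le_of_finrank_le (hoffmanSpan_le_mzvSpace n) (hH ▸ hle)
  refine ⟨heq, ?_⟩
  rw [← heq, hH]

/-! ### The printed form of Hoffman's conjecture (Brown's Conjecture 2) -/

/-- `hoffmanSpan_eq_mzvSpace` is equivalent to the printed form of Hoffman's conjecture
(Brown 2012, §1, Conjecture 2, graded by weight): every multiple zeta value `ζ(s)` of an
admissible index `s` is a `ℚ`-linear combination of Hoffman elements of the same weight.
[cite: Brown2012, §1 Conjecture 2] -/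
theorem hoffmanSpan_eq_mzvSpace_iff :
    hoffmanSpan_eq_mzvSpace ↔
      ∀ s : List ℕ, MZV.IsAdmissible s → multipleZeta s ∈ hoffmanSpan (MZV.weight s) := by
  constructor
  · intro h s hs
    rw [h (MZV.weight s)]
    exact Submodule.subset_span ⟨s, hs, rfl, rfl⟩
  · intro h n
    refine le_antisymm (hoffmanSpan_le_mzvSpace n) ?_
    rw [mzvSpace, Submodule.span_le]
    rintro x ⟨s, hs, rfl, rfl⟩
    exact h s hs

/-- One inclusion of the fact is unconditional: to prove `hoffmanSpan n = mzvSpace n` in a given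
weight it suffices to put every admissible `ζ(s)` of weight `n` in the Hoffman span. [folklore] -/
theorem hoffmanSpan_eq_mzvSpace_of_forall_mem {n : ℕ}
    (h : ∀ s : List ℕ, MZV.IsAdmissible s → MZV.weight s = n → multipleZeta s ∈ hoffmanSpan n) :
    hoffmanSpan n = mzvSpace n := by
  refine le_antisymm (hoffmanSpan_le_mzvSpace n) ?_
  rw [mzvSpace, Submodule.span_le]
  rintro x ⟨s, hs, hw, rfl⟩
  exact h s hs hw

/-! ### Low weights: the fact holds in weights `≤ 3` -/

/-- Weight `0`: `𝒵₀ = ℚ · ζ(∅) = ℚ · 1` and `∅` is a Hoffman index. [folklore] -/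
theorem hoffmanSpan_zero_eq : hoffmanSpan 0 = mzvSpace 0 :=
  hoffmanSpan_eq_mzvSpace_of_forall_mem fun s hs hw => by
    -- an admissible index of weight `0` is empty (a nonempty one has weight `≥ 2`)
    obtain rfl : s = [] := by
      rcases eq_or_ne s [] with h | hne
      · exact h
      · have := MZV.two_le_weight_of_isAdmissible hs hne
        omega
    exact Submodule.subset_span ⟨[], MZV.isHoffman_nil, rfl, rfl⟩

/-- Weight `1`: `𝒵₁ = 0`. [folklore] -/
theorem hoffmanSpan_one_eq : hoffmanSpan 1 = mzvSpace 1 := by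
  rw [mzvSpace_one_eq_bot]
  exact le_bot_iff.1 (mzvSpace_one_eq_bot ▸ hoffmanSpan_le_mzvSpace 1)

/-- Weight `2`: `𝒵₂ = ℚ · ζ(2)` and `(2)` is a Hoffman index. [folklore] -/
theorem hoffmanSpan_two_eq : hoffmanSpan 2 = mzvSpace 2 :=
  hoffmanSpan_eq_mzvSpace_of_forall_mem fun s hs hw => by
    rw [MZV.eq_of_isAdmissible_of_weight_eq_two hs hw]
    exact Submodule.subset_span ⟨[2], MZV.isHoffman_singleton (Or.inl rfl), rfl, rfl⟩

/-- Weight `3`: `𝒵₃` is spanned by `ζ(3)` and `ζ(2,1) = ζ(3)` (Euler, `euler_zeta_two_one_holds`),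
and `(3)` is a Hoffman index. [folklore] -/
theorem hoffmanSpan_three_eq : hoffmanSpan 3 = mzvSpace 3 :=
  hoffmanSpan_eq_mzvSpace_of_forall_mem fun s hs hw => by
    have h3 : multipleZeta [3] ∈ hoffmanSpan 3 :=
      Submodule.subset_span ⟨[3], MZV.isHoffman_singleton (Or.inr rfl), rfl, rfl⟩
    rcases MZV.eq_of_isAdmissible_of_weight_eq_three hs hw with rfl | rfl
    · exact h3
    · have h21 : multipleZeta [2, 1] = multipleZeta [3] := euler_zeta_two_one_holds
      rw [h21]
      exact h3

/-- **Brown's theorem in weights `≤ 3`** (elementary there): `hoffmanSpan n = mzvSpace n` for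
`n = 0, 1, 2, 3`. From weight `4` on the tree lacks the needed evaluations
(`ζ(3,1), ζ(2,1,1) ∈ ℚ ζ(2,2)`), and in general the statement is Brown's theorem.
[cite: Brown2012, §1 Conjecture 2 and Theorem 1.1] -/
theorem hoffmanSpan_eq_mzvSpace_of_le_three {n : ℕ} (hn : n ≤ 3) : hoffmanSpan n = mzvSpace n := by
  interval_cases n
  · exact hoffmanSpan_zero_eq
  · exact hoffmanSpan_one_eq
  · exact hoffmanSpan_two_eq
  · exact hoffmanSpan_three_eq

/-- The upper bound `dim_ℚ 𝒵_n ≤ d_n` (named fact `finrank_mzvSpace_le_zagierDim`) holds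
unconditionally in weights `n ≤ 3`. [folklore] -/
theorem finrank_mzvSpace_le_zagierDim_of_le_three {n : ℕ} (hn : n ≤ 3) :
    Module.finrank ℚ (mzvSpace n) ≤ zagierDim n :=
  finrank_mzvSpace_le_zagierDim_of_eq (hoffmanSpan_eq_mzvSpace_of_le_three hn)

/-! ### Weight `4`: the fact holds in weights `≤ 4` -/

/-- A Hoffman index of weight `4` is `(2, 2)` (the admissible indices of weight `4` being
`(4), (3,1), (2,2), (2,1,1)`). [folklore] -/
theorem MZV.eq_of_isHoffman_of_weight_eq_four {s : List ℕ} (h : MZV.IsHoffman s)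
    (hw : MZV.weight s = 4) : s = [2, 2] := by
  rcases MZV.eq_of_isAdmissible_of_weight_eq_four h.isAdmissible hw with rfl | rfl | rfl | rfl
  · rcases h 4 (by simp) with h4 | h4 <;> omega
  · rcases h 1 (by simp) with h1 | h1 <;> omega
  · rfl
  · rcases h 1 (by simp) with h1 | h1 <;> omega

/-- `π⁴ = 120 · ζ(2,2)` (`multipleZeta_two_two`) lies in the Hoffman span of weight `4`.
[cite: ChmutovDuzhinMostovoy2012, §10.2.6] -/
theorem pi_pow_four_mem_hoffmanSpan : Real.pi ^ 4 ∈ hoffmanSpan 4 := by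
  have h : Real.pi ^ 4 = (120 : ℚ) • multipleZeta [2, 2] := by
    rw [multipleZeta_two_two, Rat.smul_def]; push_cast; ring
  rw [h]
  exact Submodule.smul_mem _ _ (Submodule.subset_span
    ⟨[2, 2], MZV.isHoffman_cons.2 ⟨Or.inl rfl, MZV.isHoffman_singleton (Or.inl rfl)⟩, rfl, rfl⟩)

/-- **Brown's theorem in weight `4`** (elementary there): `hoffmanSpan 4 = mzvSpace 4`, i.e. every
multiple zeta value of weight `4` is a rational multiple of the single Hoffman element `ζ(2,2)`:
`ζ(4) = (4/3) ζ(2,2)`, `ζ(3,1) = (1/3) ζ(2,2)`, `ζ(2,1,1) = (4/3) ζ(2,2)` — from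
`𝒵₄ ⊆ ℚ π⁴` (`multipleZeta_mem_span_pi_pow_four`: the four weight-`4` evaluations of
Chmutov–Duzhin–Mostovoy 2012, §10.2.6) and `π⁴ = 120 ζ(2,2)`.
[cite: Brown2012, §1 Conjecture 2 and Theorem 1.1] -/
theorem hoffmanSpan_four_eq : hoffmanSpan 4 = mzvSpace 4 :=
  hoffmanSpan_eq_mzvSpace_of_forall_mem fun _ hs hw =>
    (Submodule.span_le.2 (Set.singleton_subset_iff.2 pi_pow_four_mem_hoffmanSpan))
      (multipleZeta_mem_span_pi_pow_four hs hw)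

/-- The Hoffman span of weight `4` is the line `ℚ · π⁴` (`= ℚ · ζ(2,2)`). [folklore] -/
theorem hoffmanSpan_four_eq_span_pi_pow_four : hoffmanSpan 4 = Submodule.span ℚ {Real.pi ^ 4} :=
  hoffmanSpan_four_eq.trans mzvSpace_four_eq

/-- **Brown's theorem in weights `≤ 4`** (elementary there): `hoffmanSpan n = mzvSpace n` for
`n = 0, 1, 2, 3, 4` — exactly the weights with `d_n ≤ 1`. From weight `5` on (`d₅ = 2`, Hoffman
indices `(3,2)`, `(2,3)`) the weight-wise statement needs the double shuffle relations of that
weight, and in general it is Brown's theorem. [cite: Brown2012, §1 Conjecture 2 and Theorem 1.1] -/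
theorem hoffmanSpan_eq_mzvSpace_of_le_four {n : ℕ} (hn : n ≤ 4) : hoffmanSpan n = mzvSpace n := by
  rcases hn.lt_or_eq with h | rfl
  · exact hoffmanSpan_eq_mzvSpace_of_le_three (Nat.lt_succ_iff.1 h)
  · exact hoffmanSpan_four_eq

/-- The upper bound `dim_ℚ 𝒵_n ≤ d_n` (named fact `finrank_mzvSpace_le_zagierDim`) holds
unconditionally in weights `n ≤ 4` (indeed with equality, `finrank_mzvSpace_eq_zagierDim_of_le_four`).
[folklore] -/
theorem finrank_mzvSpace_le_zagierDim_of_le_four {n : ℕ} (hn : n ≤ 4) :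
    Module.finrank ℚ (mzvSpace n) ≤ zagierDim n :=
  finrank_mzvSpace_le_zagierDim_of_eq (hoffmanSpan_eq_mzvSpace_of_le_four hn)

/-- In weights `n ≤ 4` the real Hoffman elements of weight `n` are `ℚ`-linearly independent (there
is at most one, `ζ(∅) = 1`, `ζ(2)`, `ζ(3)` or `ζ(2,2)`, and it is nonzero), so that both
hypotheses of `hoffmanSpan_eq_mzvSpace_of_linearIndependent` hold there; from weight `5` on this
independence is open for real MZVs. [folklore] -/
theorem linearIndependent_hoffman_of_le_four {n : ℕ} (hn : n ≤ 4) :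
    LinearIndependent ℚ
      fun s : {s : List ℕ // MZV.IsHoffman s ∧ MZV.weight s = n} => multipleZeta s.1 := by
  -- at most one Hoffman index in each weight `≤ 4` (`d_n ≤ 1`), and its MZV is nonzero
  haveI : Subsingleton {s : List ℕ // MZV.IsHoffman s ∧ MZV.weight s = n} := by
    haveI := finite_hoffman n
    refine Finite.card_le_one_iff_subsingleton.1 ?_
    rw [← zagierDim_eq_card_hoffman_holds n]
    interval_cases n <;> decide
  exact (linearIndependent_subsingleton_index_iff _).2 fun s =>
    (multipleZeta_pos_of_isAdmissible_holds s.2.1.isAdmissible).ne'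

/-! ### Weight `5`: the fact holds in weights `≤ 5` -/

/-- A Hoffman index of weight `5` is `(3, 2)` or `(2, 3)`. [folklore] -/
theorem MZV.eq_of_isHoffman_of_weight_eq_five {s : List ℕ} (h : MZV.IsHoffman s)
    (hw : MZV.weight s = 5) : s = [3, 2] ∨ s = [2, 3] := by
  rcases MZV.eq_of_isAdmissible_of_weight_eq_five h.isAdmissible hw with
    rfl | rfl | rfl | rfl | rfl | rfl | rfl | rfl
  · rcases h 5 (by simp) with h5 | h5 <;> omega
  · rcases h 1 (by simp) with h1 | h1 <;> omega
  · exact Or.inl rfl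
  · exact Or.inr rfl
  all_goals rcases h 1 (by simp) with h1 | h1 <;> omega

/-- The two Hoffman elements of weight `5` span a subspace of the Hoffman span of weight `5`
(indeed all of it). [folklore] -/
theorem span_hoffman_five_le :
    Submodule.span ℚ {multipleZeta [3, 2], multipleZeta [2, 3]} ≤ hoffmanSpan 5 := by
  rw [Submodule.span_le]
  rintro x hx
  rcases hx with rfl | rfl
  · exact Submodule.subset_span ⟨[3, 2],
      MZV.isHoffman_cons.2 ⟨Or.inr rfl, MZV.isHoffman_singleton (Or.inl rfl)⟩, rfl, rfl⟩
  · exact Submodule.subset_span ⟨[2, 3],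
      MZV.isHoffman_cons.2 ⟨Or.inl rfl, MZV.isHoffman_singleton (Or.inr rfl)⟩, rfl, rfl⟩

/-- **Brown's theorem in weight `5`** (elementary there; Hoffman 1992, §5: for `n = 5` "all
instances of both conjectures hold"): `hoffmanSpan 5 = mzvSpace 5`, i.e. every multiple zeta
value of weight `5` is a rational combination of `ζ(3,2)` and `ζ(2,3)` —
`ζ(5) = (4ζ(3,2) + 6ζ(2,3))/5`, `ζ(4,1) = (ζ(2,3) - ζ(3,2))/5`, `ζ(3,1,1) = ζ(4,1)`,
`ζ(2,2,1) = ζ(3,2)`, `ζ(2,1,2) = ζ(2,3)`, `ζ(2,1,1,1) = ζ(5)`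
(`multipleZeta_mem_span_hoffman_of_weight_five`: double shuffle and duality in weight `5`).
[cite: Brown2012, §1 Conjecture 2 and Theorem 1.1] -/
theorem hoffmanSpan_five_eq : hoffmanSpan 5 = mzvSpace 5 :=
  hoffmanSpan_eq_mzvSpace_of_forall_mem fun _ hs hw =>
    span_hoffman_five_le (multipleZeta_mem_span_hoffman_of_weight_five hs hw)

/-- The Hoffman span of weight `5` is the plane-or-line `ℚ ζ(3,2) + ℚ ζ(2,3)` (a plane iff
`ζ(5) ∉ ℚ ζ(2)ζ(3)`, which is open). [folklore] -/
theorem hoffmanSpan_five_eq_span :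
    hoffmanSpan 5 = Submodule.span ℚ {multipleZeta [3, 2], multipleZeta [2, 3]} :=
  hoffmanSpan_five_eq.trans mzvSpace_five_eq_span_hoffman

/-- **Brown's theorem in weights `≤ 5`** (elementary there): `hoffmanSpan n = mzvSpace n` for
`n = 0, …, 5`. [cite: Brown2012, §1 Conjecture 2 and Theorem 1.1] -/
theorem hoffmanSpan_eq_mzvSpace_of_le_five {n : ℕ} (hn : n ≤ 5) : hoffmanSpan n = mzvSpace n := by
  rcases hn.lt_or_eq with h | rfl
  · exact hoffmanSpan_eq_mzvSpace_of_le_four (Nat.lt_succ_iff.1 h)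
  · exact hoffmanSpan_five_eq

/-- The upper bound `dim_ℚ 𝒵_n ≤ d_n` (named fact `finrank_mzvSpace_le_zagierDim`; Terasoma 2002,
Deligne–Goncharov 2005) holds unconditionally in weights `n ≤ 5`; `n = 5` (`d₅ = 2`) is its first
case beyond the classical evaluations. [folklore] -/
theorem finrank_mzvSpace_le_zagierDim_of_le_five {n : ℕ} (hn : n ≤ 5) :
    Module.finrank ℚ (mzvSpace n) ≤ zagierDim n :=
  finrank_mzvSpace_le_zagierDim_of_eq (hoffmanSpan_eq_mzvSpace_of_le_five hn)

/-! ### Weight `6`: the fact holds in weights `≤ 6` -/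

/-- A Hoffman index of weight `6` is `(3, 3)` or `(2, 2, 2)`. [folklore] -/
theorem MZV.eq_of_isHoffman_of_weight_eq_six {s : List ℕ} (h : MZV.IsHoffman s)
    (hw : MZV.weight s = 6) : s = [3, 3] ∨ s = [2, 2, 2] := by
  rcases MZV.eq_of_isAdmissible_of_weight_eq_six h.isAdmissible hw with
    rfl | rfl | rfl | rfl | rfl | rfl | rfl | rfl | rfl | rfl | rfl | rfl | rfl | rfl | rfl | rfl
  all_goals first
    | exact Or.inl rfl
    | exact Or.inr rfl
    | exact absurd h (by decide)

/-- The two Hoffman elements of weight `6` span a subspace of the Hoffman span of weight `6`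
(indeed all of it). [folklore] -/
theorem span_hoffman_six_le :
    Submodule.span ℚ {multipleZeta [2, 2, 2], multipleZeta [3, 3]} ≤ hoffmanSpan 6 := by
  rw [Submodule.span_le]
  rintro x hx
  rcases hx with rfl | rfl
  · exact Submodule.subset_span ⟨[2, 2, 2], by decide, rfl, rfl⟩
  · exact Submodule.subset_span ⟨[3, 3], by decide, rfl, rfl⟩

/-- **Brown's theorem in weight `6`** (elementary there; Hoffman 1992, §5: "all instances of both
conjectures are true when `n = 6`"): `hoffmanSpan 6 = mzvSpace 6`, i.e. every multiple zeta
value of weight `6` is a rational combination of `ζ(2,2,2)` and `ζ(3,3)` — e.g.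
`ζ(6) = (16/3) ζ(2,2,2)`, `ζ(2,1,3) = ζ(2,2,2) + 2ζ(3,3)`
(`multipleZeta_mem_span_hoffman_of_weight_six`: double shuffle and duality in weight `6`).
[cite: Brown2012, §1 Conjecture 2 and Theorem 1.1] -/
theorem hoffmanSpan_six_eq : hoffmanSpan 6 = mzvSpace 6 :=
  hoffmanSpan_eq_mzvSpace_of_forall_mem fun _ hs hw =>
    span_hoffman_six_le (multipleZeta_mem_span_hoffman_of_weight_six hs hw)

/-- The Hoffman span of weight `6` is `ℚ ζ(2,2,2) + ℚ ζ(3,3) = ℚ π⁶ + ℚ ζ(3)²` (a plane iff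
`ζ(3)² / π⁶ ∉ ℚ`, which is open). [folklore] -/
theorem hoffmanSpan_six_eq_span :
    hoffmanSpan 6 = Submodule.span ℚ {multipleZeta [2, 2, 2], multipleZeta [3, 3]} :=
  hoffmanSpan_six_eq.trans mzvSpace_six_eq_span_hoffman

/-- **Brown's theorem in weights `≤ 6`** (elementary there): `hoffmanSpan n = mzvSpace n` for
`n = 0, …, 6` — the range of Hoffman's original verification of his conjectures (1992, §5).
[cite: Brown2012, §1 Conjecture 2 and Theorem 1.1] -/
theorem hoffmanSpan_eq_mzvSpace_of_le_six {n : ℕ} (hn : n ≤ 6) : hoffmanSpan n = mzvSpace n := by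
  rcases hn.lt_or_eq with h | rfl
  · exact hoffmanSpan_eq_mzvSpace_of_le_five (Nat.lt_succ_iff.1 h)
  · exact hoffmanSpan_six_eq

/-- The upper bound `dim_ℚ 𝒵_n ≤ d_n` (named fact `finrank_mzvSpace_le_zagierDim`; Terasoma 2002,
Deligne–Goncharov 2005) holds unconditionally in weights `n ≤ 6` (`d₀, …, d₆ = 1, 0, 1, 1, 1, 2, 2`).
[folklore] -/
theorem finrank_mzvSpace_le_zagierDim_of_le_six {n : ℕ} (hn : n ≤ 6) :
    Module.finrank ℚ (mzvSpace n) ≤ zagierDim n :=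
  finrank_mzvSpace_le_zagierDim_of_eq (hoffmanSpan_eq_mzvSpace_of_le_six hn)

/-! ### Weight `7`: the fact holds in weights `≤ 7` -/

/-- A Hoffman index of weight `7` is `(3,2,2)`, `(2,3,2)` or `(2,2,3)`. [folklore] -/
theorem MZV.eq_of_isHoffman_of_weight_eq_seven {s : List ℕ} (h : MZV.IsHoffman s)
    (hw : MZV.weight s = 7) : s = [3, 2, 2] ∨ s = [2, 3, 2] ∨ s = [2, 2, 3] := by
  rcases MZV.eq_of_isAdmissible_of_weight_eq_seven h.isAdmissible hw with
    rfl | rfl | rfl | rfl | rfl | rfl | rfl | rfl | rfl | rfl | rfl | rfl | rfl | rfl | rfl | rfl |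
    rfl | rfl | rfl | rfl | rfl | rfl | rfl | rfl | rfl | rfl | rfl | rfl | rfl | rfl | rfl | rfl
  all_goals first
    | exact Or.inl rfl
    | exact Or.inr (Or.inl rfl)
    | exact Or.inr (Or.inr rfl)
    | exact absurd h (by decide)

/-- The three Hoffman elements of weight `7` span a subspace of the Hoffman span of weight `7`
(indeed all of it). [folklore] -/
theorem span_hoffman_seven_le :
    Submodule.span ℚ {multipleZeta [3, 2, 2], multipleZeta [2, 3, 2], multipleZeta [2, 2, 3]} ≤
      hoffmanSpan 7 := by
  rw [Submodule.span_le]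
  rintro x hx
  rcases hx with rfl | rfl | rfl
  · exact Submodule.subset_span ⟨[3, 2, 2], by decide, rfl, rfl⟩
  · exact Submodule.subset_span ⟨[2, 3, 2], by decide, rfl, rfl⟩
  · exact Submodule.subset_span ⟨[2, 2, 3], by decide, rfl, rfl⟩

/-- **Brown's theorem in weight `7`** (elementary there, through the finite double shuffle
relations and duality): `hoffmanSpan 7 = mzvSpace 7`, i.e. every multiple zeta value of weight
`7` is a rational combination of `ζ(3,2,2)`, `ζ(2,3,2)`, `ζ(2,2,3)` — e.g.
`151 ζ(7) = 352 ζ(3,2,2) + 672 ζ(2,3,2) + 528 ζ(2,2,3)`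
(`multipleZeta_mem_span_hoffman_of_weight_seven`). [cite: Brown2012, §1 Conjecture 2 and Theorem 1.1] -/
theorem hoffmanSpan_seven_eq : hoffmanSpan 7 = mzvSpace 7 :=
  hoffmanSpan_eq_mzvSpace_of_forall_mem fun _ hs hw =>
    span_hoffman_seven_le (multipleZeta_mem_span_hoffman_of_weight_seven hs hw)

/-- The Hoffman span of weight `7` is `ℚ ζ(3,2,2) + ℚ ζ(2,3,2) + ℚ ζ(2,2,3)
= ℚ ζ(7) + ℚ π²ζ(5) + ℚ π⁴ζ(3)`. [folklore] -/
theorem hoffmanSpan_seven_eq_span :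
    hoffmanSpan 7 =
      Submodule.span ℚ {multipleZeta [3, 2, 2], multipleZeta [2, 3, 2], multipleZeta [2, 2, 3]} :=
  hoffmanSpan_seven_eq.trans mzvSpace_seven_eq_span_hoffman

/-- **Brown's theorem in weights `≤ 7`** (elementary there): `hoffmanSpan n = mzvSpace n` for
`n = 0, …, 7`. [cite: Brown2012, §1 Conjecture 2 and Theorem 1.1] -/
theorem hoffmanSpan_eq_mzvSpace_of_le_seven {n : ℕ} (hn : n ≤ 7) : hoffmanSpan n = mzvSpace n := by
  rcases hn.lt_or_eq with h | rfl
  · exact hoffmanSpan_eq_mzvSpace_of_le_six (Nat.lt_succ_iff.1 h)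
  · exact hoffmanSpan_seven_eq

/-- The upper bound `dim_ℚ 𝒵_n ≤ d_n` (named fact `finrank_mzvSpace_le_zagierDim`; Terasoma 2002,
Deligne–Goncharov 2005) holds unconditionally in weights `n ≤ 7`
(`d₀, …, d₇ = 1, 0, 1, 1, 1, 2, 2, 3`). [folklore] -/
theorem finrank_mzvSpace_le_zagierDim_of_le_seven {n : ℕ} (hn : n ≤ 7) :
    Module.finrank ℚ (mzvSpace n) ≤ zagierDim n :=
  finrank_mzvSpace_le_zagierDim_of_eq (hoffmanSpan_eq_mzvSpace_of_le_seven hn)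

/-! ### Weight `8`: the fact holds in weights `≤ 8` -/

set_option maxHeartbeats 800000 in
/-- A Hoffman index of weight `8` is `(2,2,2,2)`, `(2,3,3)`, `(3,2,3)` or `(3,3,2)`. [folklore] -/
theorem MZV.eq_of_isHoffman_of_weight_eq_eight {s : List ℕ} (h : MZV.IsHoffman s)
    (hw : MZV.weight s = 8) :
    s = [2, 2, 2, 2] ∨ s = [2, 3, 3] ∨ s = [3, 2, 3] ∨ s = [3, 3, 2] := by
  rcases MZV.eq_of_isAdmissible_of_weight_eq_eight h.isAdmissible hw with
    rfl | rfl | rfl | rfl | rfl | rfl | rfl | rfl |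
    rfl | rfl | rfl | rfl | rfl | rfl | rfl | rfl |
    rfl | rfl | rfl | rfl | rfl | rfl | rfl | rfl |
    rfl | rfl | rfl | rfl | rfl | rfl | rfl | rfl |
    rfl | rfl | rfl | rfl | rfl | rfl | rfl | rfl |
    rfl | rfl | rfl | rfl | rfl | rfl | rfl | rfl |
    rfl | rfl | rfl | rfl | rfl | rfl | rfl | rfl |
    rfl | rfl | rfl | rfl | rfl | rfl | rfl | rfl
  all_goals first
    | exact Or.inl rfl
    | exact Or.inr (Or.inl rfl)
    | exact Or.inr (Or.inr (Or.inl rfl))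
    | exact Or.inr (Or.inr (Or.inr rfl))
    | exact absurd h (by decide)

/-- The four Hoffman elements of weight `8` span a subspace of the Hoffman span of weight `8`
(indeed all of it). [folklore] -/
theorem span_hoffman_eight_le :
    Submodule.span ℚ {multipleZeta [2, 2, 2, 2], multipleZeta [2, 3, 3], multipleZeta [3, 2, 3],
      multipleZeta [3, 3, 2]} ≤ hoffmanSpan 8 := by
  rw [Submodule.span_le]
  rintro x hx
  rcases hx with rfl | rfl | rfl | rfl
  · exact Submodule.subset_span ⟨[2, 2, 2, 2], by decide, rfl, rfl⟩
  · exact Submodule.subset_span ⟨[2, 3, 3], by decide, rfl, rfl⟩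
  · exact Submodule.subset_span ⟨[3, 2, 3], by decide, rfl, rfl⟩
  · exact Submodule.subset_span ⟨[3, 3, 2], by decide, rfl, rfl⟩

/-- **Brown's theorem in weight `8`** (elementary there, through the finite double shuffle
relations and duality): `hoffmanSpan 8 = mzvSpace 8`, i.e. every multiple zeta value of weight
`8` is a rational combination of `ζ(2,2,2,2)`, `ζ(2,3,3)`, `ζ(3,2,3)`, `ζ(3,3,2)` — e.g.
`π⁸ = 362880 ζ(2,2,2,2)` (`= 9! ζ({2}⁴)`) — (`multipleZeta_mem_span_hoffman_of_weight_eight`).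
[cite: Brown2012, §1 Conjecture 2 and Theorem 1.1] -/
theorem hoffmanSpan_eight_eq : hoffmanSpan 8 = mzvSpace 8 :=
  hoffmanSpan_eq_mzvSpace_of_forall_mem fun _ hs hw =>
    span_hoffman_eight_le (multipleZeta_mem_span_hoffman_of_weight_eight hs hw)

/-- The Hoffman span of weight `8` is `ℚ ζ(2,2,2,2) + ℚ ζ(2,3,3) + ℚ ζ(3,2,3) + ℚ ζ(3,3,2)
= ℚ ζ(6,2) + ℚ π⁸ + ℚ π²ζ(3)² + ℚ ζ(3)ζ(5)`. [folklore] -/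
theorem hoffmanSpan_eight_eq_span :
    hoffmanSpan 8 = Submodule.span ℚ {multipleZeta [2, 2, 2, 2], multipleZeta [2, 3, 3],
      multipleZeta [3, 2, 3], multipleZeta [3, 3, 2]} :=
  hoffmanSpan_eight_eq.trans mzvSpace_eight_eq_span_hoffman

/-- **Brown's theorem in weights `≤ 8`** (elementary there): `hoffmanSpan n = mzvSpace n` for
`n = 0, …, 8`. [cite: Brown2012, §1 Conjecture 2 and Theorem 1.1] -/
theorem hoffmanSpan_eq_mzvSpace_of_le_eight {n : ℕ} (hn : n ≤ 8) : hoffmanSpan n = mzvSpace n := by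
  rcases hn.lt_or_eq with h | rfl
  · exact hoffmanSpan_eq_mzvSpace_of_le_seven (Nat.lt_succ_iff.1 h)
  · exact hoffmanSpan_eight_eq

/-- The upper bound `dim_ℚ 𝒵_n ≤ d_n` (named fact `finrank_mzvSpace_le_zagierDim`; Terasoma 2002,
Deligne–Goncharov 2005) holds unconditionally in weights `n ≤ 8`
(`d₀, …, d₈ = 1, 0, 1, 1, 1, 2, 2, 3, 4`). [folklore] -/
theorem finrank_mzvSpace_le_zagierDim_of_le_eight {n : ℕ} (hn : n ≤ 8) :
    Module.finrank ℚ (mzvSpace n) ≤ zagierDim n :=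
  finrank_mzvSpace_le_zagierDim_of_eq (hoffmanSpan_eq_mzvSpace_of_le_eight hn)

/-! ### Weight `9`: the fact holds in weights `≤ 9` -/

set_option maxHeartbeats 1600000 in
/-- A Hoffman index of weight `9` is `(3,3,3)`, `(3,2,2,2)`, `(2,3,2,2)`, `(2,2,3,2)` or `(2,2,2,3)`.
[folklore] -/
theorem MZV.eq_of_isHoffman_of_weight_eq_nine {s : List ℕ} (h : MZV.IsHoffman s)
    (hw : MZV.weight s = 9) :
    s = [3, 3, 3] ∨ s = [3, 2, 2, 2] ∨ s = [2, 3, 2, 2] ∨ s = [2, 2, 3, 2] ∨ s = [2, 2, 2, 3] := by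
  rcases MZV.eq_of_isAdmissible_of_weight_eq_nine h.isAdmissible hw with
    rfl | rfl | rfl | rfl | rfl | rfl | rfl | rfl |
    rfl | rfl | rfl | rfl | rfl | rfl | rfl | rfl |
    rfl | rfl | rfl | rfl | rfl | rfl | rfl | rfl |
    rfl | rfl | rfl | rfl | rfl | rfl | rfl | rfl |
    rfl | rfl | rfl | rfl | rfl | rfl | rfl | rfl |
    rfl | rfl | rfl | rfl | rfl | rfl | rfl | rfl |
    rfl | rfl | rfl | rfl | rfl | rfl | rfl | rfl |
    rfl | rfl | rfl | rfl | rfl | rfl | rfl | rfl |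
    rfl | rfl | rfl | rfl | rfl | rfl | rfl | rfl |
    rfl | rfl | rfl | rfl | rfl | rfl | rfl | rfl |
    rfl | rfl | rfl | rfl | rfl | rfl | rfl | rfl |
    rfl | rfl | rfl | rfl | rfl | rfl | rfl | rfl |
    rfl | rfl | rfl | rfl | rfl | rfl | rfl | rfl |
    rfl | rfl | rfl | rfl | rfl | rfl | rfl | rfl |
    rfl | rfl | rfl | rfl | rfl | rfl | rfl | rfl |
    rfl | rfl | rfl | rfl | rfl | rfl | rfl | rfl
  all_goals first
    | exact Or.inl rfl
    | exact Or.inr (Or.inl rfl)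
    | exact Or.inr (Or.inr (Or.inl rfl))
    | exact Or.inr (Or.inr (Or.inr (Or.inl rfl)))
    | exact Or.inr (Or.inr (Or.inr (Or.inr rfl)))
    | exact absurd h (by decide)

/-- The five Hoffman elements of weight `9` span a subspace of the Hoffman span of weight `9`
(indeed all of it). [folklore] -/
theorem span_hoffman_nine_le :
    Submodule.span ℚ {multipleZeta [3, 3, 3], multipleZeta [3, 2, 2, 2], multipleZeta [2, 3, 2, 2],
      multipleZeta [2, 2, 3, 2], multipleZeta [2, 2, 2, 3]} ≤ hoffmanSpan 9 := by
  rw [Submodule.span_le]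
  rintro x hx
  rcases hx with rfl | rfl | rfl | rfl | rfl
  · exact Submodule.subset_span ⟨[3, 3, 3], by decide, rfl, rfl⟩
  · exact Submodule.subset_span ⟨[3, 2, 2, 2], by decide, rfl, rfl⟩
  · exact Submodule.subset_span ⟨[2, 3, 2, 2], by decide, rfl, rfl⟩
  · exact Submodule.subset_span ⟨[2, 2, 3, 2], by decide, rfl, rfl⟩
  · exact Submodule.subset_span ⟨[2, 2, 2, 3], by decide, rfl, rfl⟩

/-- **Brown's theorem in weight `9`** (elementary there, through the finite double shuffle
relations and duality): `hoffmanSpan 9 = mzvSpace 9`, i.e. every multiple zeta value of weight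
`9` is a rational combination of `ζ(3,3,3)`, `ζ(3,2,2,2)`, `ζ(2,3,2,2)`, `ζ(2,2,3,2)`, `ζ(2,2,2,3)` — e.g.
`4865 ζ(9) = 63136 ζ(3,2,2,2) + 127584 ζ(2,3,2,2) + 146976 ζ(2,2,3,2) + 94704 ζ(2,2,2,3)`
(`multipleZeta_mem_span_hoffman_of_weight_nine`). [cite: Brown2012, §1 Conjecture 2 and Theorem 1.1] -/
theorem hoffmanSpan_nine_eq : hoffmanSpan 9 = mzvSpace 9 :=
  hoffmanSpan_eq_mzvSpace_of_forall_mem fun _ hs hw =>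
    span_hoffman_nine_le (multipleZeta_mem_span_hoffman_of_weight_nine hs hw)

/-- The Hoffman span of weight `9` is the span of the five Hoffman elements
`= ℚ ζ(9) + ℚ π²ζ(7) + ℚ π⁴ζ(5) + ℚ π⁶ζ(3) + ℚ ζ(3)³`. [folklore] -/
theorem hoffmanSpan_nine_eq_span :
    hoffmanSpan 9 = Submodule.span ℚ {multipleZeta [3, 3, 3], multipleZeta [3, 2, 2, 2],
      multipleZeta [2, 3, 2, 2], multipleZeta [2, 2, 3, 2], multipleZeta [2, 2, 2, 3]} :=
  hoffmanSpan_nine_eq.trans mzvSpace_nine_eq_span_hoffman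

/-- **Brown's theorem in weights `≤ 9`** (elementary there): `hoffmanSpan n = mzvSpace n` for
`n = 0, …, 9`. [cite: Brown2012, §1 Conjecture 2 and Theorem 1.1] -/
theorem hoffmanSpan_eq_mzvSpace_of_le_nine {n : ℕ} (hn : n ≤ 9) : hoffmanSpan n = mzvSpace n := by
  rcases hn.lt_or_eq with h | rfl
  · exact hoffmanSpan_eq_mzvSpace_of_le_eight (Nat.lt_succ_iff.1 h)
  · exact hoffmanSpan_nine_eq

/-- The upper bound `dim_ℚ 𝒵_n ≤ d_n` (named fact `finrank_mzvSpace_le_zagierDim`; Terasoma 2002,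
Deligne–Goncharov 2005) holds unconditionally in weights `n ≤ 9`
(`d₀, …, d₉ = 1, 0, 1, 1, 1, 2, 2, 3, 4, 5`). [folklore] -/
theorem finrank_mzvSpace_le_zagierDim_of_le_nine {n : ℕ} (hn : n ≤ 9) :
    Module.finrank ℚ (mzvSpace n) ≤ zagierDim n :=
  finrank_mzvSpace_le_zagierDim_of_eq (hoffmanSpan_eq_mzvSpace_of_le_nine hn)

/-! ### What the fact gives its users, and the unconditional cases (weights `≤ 9`) -/

/-- Unpacking a membership `x ∈ hoffmanSpan n`: `x` is an explicit finite rational combination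
`∑ᵢ qᵢ ζ(tᵢ)` of Hoffman elements `tᵢ ∈ {2,3}^×` of weight `n`. [folklore] -/
theorem exists_sum_hoffman_of_mem_hoffmanSpan {x : ℝ} {n : ℕ} (hx : x ∈ hoffmanSpan n) :
    ∃ (k : ℕ) (q : Fin k → ℚ) (t : Fin k → List ℕ),
      (∀ i, MZV.IsHoffman (t i) ∧ MZV.weight (t i) = n) ∧
        x = ∑ i, (q i : ℝ) * multipleZeta (t i) := by
  rw [hoffmanSpan, Submodule.mem_span_set'] at hx
  obtain ⟨k, f, g, hfg⟩ := hx
  have hg : ∀ i, ∃ t, MZV.IsHoffman t ∧ MZV.weight t = n ∧ ((g i : ℝ)) = multipleZeta t :=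
    fun i => (g i).2
  choose t ht using hg
  refine ⟨k, f, t, fun i => ⟨(ht i).1, (ht i).2.1⟩, ?_⟩
  rw [← hfg]
  refine Finset.sum_congr rfl fun i _ => ?_
  rw [(ht i).2.2, Rat.smul_def]

/-- **What `hoffmanSpan_eq_mzvSpace` gives its users** — the printed form of Brown's Theorem 1.1 /
Hoffman's Conjecture 2: every multiple zeta value `ζ(s)` (`s` admissible) is a finite rational
combination `ζ(s) = ∑ᵢ qᵢ ζ(tᵢ)` of Hoffman elements `tᵢ ∈ {2,3}^×` of the same weight.
[cite: Brown2012, §1 Conjecture 2 and Theorem 1.1] -/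
theorem hoffmanSpan_eq_mzvSpace.exists_sum_hoffman (h : hoffmanSpan_eq_mzvSpace) {s : List ℕ}
    (hs : MZV.IsAdmissible s) :
    ∃ (k : ℕ) (q : Fin k → ℚ) (t : Fin k → List ℕ),
      (∀ i, MZV.IsHoffman (t i) ∧ MZV.weight (t i) = MZV.weight s) ∧
        multipleZeta s = ∑ i, (q i : ℝ) * multipleZeta (t i) :=
  exists_sum_hoffman_of_mem_hoffmanSpan ((hoffmanSpan_eq_mzvSpace_iff.1 h) s hs)

/-- **What `hoffmanSpan_eq_mzvSpace` gives its users**: the Hoffman spans are closed under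
multiplication, `hoffmanSpan a · hoffmanSpan b ⊆ hoffmanSpan (a + b)` (via the harmonic product
`𝒵_a 𝒵_b ⊆ 𝒵_{a+b}`, `mem_mzvSpace_mul_holds`) — although the stuffle product of two Hoffman
elements is not a combination of Hoffman elements term by term (it creates entries `4, 5, 6`).
[cite: Brown2012, Theorem 1.1] -/
theorem hoffmanSpan_eq_mzvSpace.mul_mem (h : hoffmanSpan_eq_mzvSpace) {a b : ℕ} {x y : ℝ}
    (hx : x ∈ hoffmanSpan a) (hy : y ∈ hoffmanSpan b) : x * y ∈ hoffmanSpan (a + b) := by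
  rw [h] at hx hy ⊢
  exact mem_mzvSpace_mul_holds hx hy

/-- Unconditionally in weights `≤ 9`: every multiple zeta value of weight `≤ 9` lies in the Hoffman
span of its weight. [cite: Brown2012, Theorem 1.1] -/
theorem multipleZeta_mem_hoffmanSpan_of_weight_le_nine {s : List ℕ} (hs : MZV.IsAdmissible s)
    (hw : MZV.weight s ≤ 9) : multipleZeta s ∈ hoffmanSpan (MZV.weight s) := by
  rw [hoffmanSpan_eq_mzvSpace_of_le_nine hw]
  exact Submodule.subset_span ⟨s, hs, rfl, rfl⟩

/-- Unconditionally in weights `≤ 9`: every multiple zeta value of weight `≤ 9` is an explicit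
finite rational combination of Hoffman elements of the same weight.
[cite: Brown2012, §1 Conjecture 2 and Theorem 1.1] -/
theorem exists_sum_hoffman_of_weight_le_nine {s : List ℕ} (hs : MZV.IsAdmissible s)
    (hw : MZV.weight s ≤ 9) :
    ∃ (k : ℕ) (q : Fin k → ℚ) (t : Fin k → List ℕ),
      (∀ i, MZV.IsHoffman (t i) ∧ MZV.weight (t i) = MZV.weight s) ∧
        multipleZeta s = ∑ i, (q i : ℝ) * multipleZeta (t i) :=
  exists_sum_hoffman_of_mem_hoffmanSpan (multipleZeta_mem_hoffmanSpan_of_weight_le_nine hs hw)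

/-- Unconditionally in total weight `≤ 9`: `hoffmanSpan a · hoffmanSpan b ⊆ hoffmanSpan (a + b)`.
[cite: Brown2012, Theorem 1.1] -/
theorem mul_mem_hoffmanSpan_of_le_nine {a b : ℕ} (hab : a + b ≤ 9) {x y : ℝ}
    (hx : x ∈ hoffmanSpan a) (hy : y ∈ hoffmanSpan b) : x * y ∈ hoffmanSpan (a + b) := by
  rw [hoffmanSpan_eq_mzvSpace_of_le_nine hab]
  exact mem_mzvSpace_mul_holds (hoffmanSpan_le_mzvSpace a hx) (hoffmanSpan_le_mzvSpace b hy)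

/-! ### A trivial lower bound: the Hoffman span is nonzero in every weight `≠ 1` -/

/-- There is a Hoffman index of every weight `n ≠ 1` (`2^{n/2}` or `3 2^{(n-3)/2}`). [folklore] -/
theorem exists_isHoffman_weight_eq {n : ℕ} (hn : n ≠ 1) :
    ∃ s : List ℕ, MZV.IsHoffman s ∧ MZV.weight s = n := by
  rcases Nat.even_or_odd n with ⟨k, rfl⟩ | ⟨k, rfl⟩
  · refine ⟨List.replicate k 2, fun i hi => Or.inl (List.eq_of_mem_replicate hi), ?_⟩
    simp [MZV.weight, List.sum_replicate]
    ring
  · refine ⟨3 :: List.replicate (k - 1) 2, fun i hi => ?_, ?_⟩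
    · simp only [List.mem_cons] at hi
      rcases hi with rfl | hi
      · exact Or.inr rfl
      · exact Or.inl (List.eq_of_mem_replicate hi)
    · simp only [MZV.weight, List.sum_cons, List.sum_replicate, smul_eq_mul]
      omega

/-- **`hoffmanSpan n ≠ 0` for `n ≠ 1`**, hence `1 ≤ dim_ℚ (hoffmanSpan n) ≤ d_n`: the Hoffman
element of a Hoffman index of weight `n` is a positive real (`multipleZeta_pos_of_isAdmissible_holds`).
[folklore] -/
theorem finrank_hoffmanSpan_pos {n : ℕ} (hn : n ≠ 1) : 0 < Module.finrank ℚ (hoffmanSpan n) := by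
  haveI : FiniteDimensional ℚ (hoffmanSpan n) :=
    Submodule.finiteDimensional_of_le (hoffmanSpan_le_mzvSpace n)
  obtain ⟨s, hs, hw⟩ := exists_isHoffman_weight_eq hn
  rw [Module.finrank_pos_iff_exists_ne_zero]
  refine ⟨⟨multipleZeta s, Submodule.subset_span ⟨s, hs, hw, rfl⟩⟩, fun h => ?_⟩
  have hpos := multipleZeta_pos_of_isAdmissible_holds hs.isAdmissible
  rw [Subtype.ext_iff] at h
  simp only [Submodule.coe_zero] at h
  linarith

end Literature.NumberTheory.Transcendental
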